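import Summits.QuantumFields.YangMills.Theorems.BalabanLadderUVOtherGroupsDefs
import Summits.QuantumFields.YangMills.Theorems.BalabanUVNodesClustersLeaf
import HarnessLib

/-!
# Route `BalabanLadder`, crux `UVOtherGroups` (stmt-QuantumFields-19356): `UVApexSUN` at Track A's Stage-0 resolution (route rev 11)

Helper file (`--supports stmt-QuantumFields-19356`, fleet seat `ym-osasm-p2`, director-ym R136 (iii)); pure theorems.  Track A's detail route
`BalabanUVNodes` returned at rev 11 (planner-pub-ymgap-plan-g64, 2026-08-26T19:36Z) to the Stage-0 («datum of record») cut: deciding theorem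
`closes (hB : StabilityBAtRecord) (hE : EndpointGivenB) (hS : SpineGivenEndpoint) : Theses.BalabanLadder.UV`, `closes := fun F => hS F (hE F (hB F))`,
its three cruxes stated over `Node00.IsDatumOfRecord₀ F 2 D` for `SU(2)`.  Every tree object in them is typed at `SU(N)`, `[NeZero N]`, so the same
three statements with `2 ↦ N` and the same one-line proof give Track A's `SU(N)` leaf `YMDAG.UVSplit.UVD59 N` — whose `∀ N ≥ 3` range is the
R85 edit's residual piece `UVApexSUN` and whose `∀ N ≥ 2` range is `UVSUN` (`Theorems/BalabanLadderUVOtherGroupsDefs.lean`):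

* `uvD59_of_stage0Chain` — (B) + window at some Stage-0 datum of record · END given (B) + window · hybrid-NE7 spine given (B) + END
  ⟹ `YMDAG.UVSplit.UVD59 N`, every `N` (at `N = 2` the three hypotheses are VERBATIM the bodies of Track A's items `StabilityBAtRecord`
  (stmt-QuantumFields-19183), `EndpointGivenB`, `SpineGivenEndpoint` (stmt-QuantumFields-19182) and the proof is its `closes`; the detail route's
  file is not imported here);
* `uv_of_stage0Chain_two` — at `N = 2`: the spine's leaf `Theses.BalabanLadder.UV` BY NAME (`YMDAG.UVSplit.uvD59_two_iff`);
* `uvApexSUN_of_stage0Chain` (`∀ N ≥ 3`), `uvSUN_of_stage0Chain` (`∀ N ≥ 2`).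

The record-pinned variants (Stage 11: `uvD59_of_recordChain₁₁C`; Stage 12: `uvD59_of_recordChain₁₂C`) are in the sibling files
`…UVOtherGroupsSUN.lean` §5 ∕ `…UVOtherGroupsRecord12.lean`.  HONEST FRAMING: the three hypotheses are Bałaban's programme per `SU(N)` ([B4]–[B16];
the `N`-dependence of every constant is unprinted); nothing is discharged; not a gap, not Clay.
-/

set_option autoImplicit false

noncomputable section

open Literature.MathematicalPhysics.QuantumFieldTheory
open Literature.MathematicalPhysics.QuantumFieldTheory.Balaban1983to89
open Literature.MathematicalPhysics.QuantumFieldTheory.Balaban1983to89.T4Continuum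

namespace Summit.QuantumFields.YangMills.Theorems.UVOtherGroups

section Stage0

variable {N : ℕ} [NeZero N]

/-- **Track A's `closes` (rev 11) at `SU(N)`**: the three Stage-0 statements with `SU(2) ↦ SU(N)` — (B) as printed + the non-vacuity window at
some datum of record · endpoint existence given (B) + window · the hybrid-NE7 spine given (B) + END — imply `YMDAG.UVSplit.UVD59 N`, for EVERY
`N`, by the detail route's own one-line proof `fun F => hS F (hE F (hB F))`. -/
theorem uvD59_of_stage0Chain
    (hB : ∀ F : T4Family, ∃ D : FiniteEpsData F (Matrix.specialUnitaryGroup (Fin N) ℂ), Node00.IsDatumOfRecord₀ F N D ∧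
      B16.EndStatementBPrinted D.C ∧ ∃ γ₁ : ℝ, 0 < γ₁ ∧ ∀ γ : ℝ, 0 < γ → γ ≤ γ₁ → ∃ P : B12.RunParams, (D.C P).flow.InInterval γ P.K)
    (hE : ∀ F : T4Family, (∃ D : FiniteEpsData F (Matrix.specialUnitaryGroup (Fin N) ℂ), Node00.IsDatumOfRecord₀ F N D ∧
        B16.EndStatementBPrinted D.C ∧ ∃ γ₁ : ℝ, 0 < γ₁ ∧ ∀ γ : ℝ, 0 < γ → γ ≤ γ₁ → ∃ P : B12.RunParams, (D.C P).flow.InInterval γ P.K) →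
      ∃ D : FiniteEpsData F (Matrix.specialUnitaryGroup (Fin N) ℂ), Node00.IsDatumOfRecord₀ F N D ∧ B16.EndStatementBPrinted D.C ∧
        DagBinding.EndpointExistence D.C.toB12)
    (hS : ∀ F : T4Family, (∃ D : FiniteEpsData F (Matrix.specialUnitaryGroup (Fin N) ℂ), Node00.IsDatumOfRecord₀ F N D ∧
        B16.EndStatementBPrinted D.C ∧ DagBinding.EndpointExistence D.C.toB12) →
      ∃ D : FiniteEpsData F (Matrix.specialUnitaryGroup (Fin N) ℂ), Node00.IsDatumOfRecord₀ F N D ∧ B16.EndStatementBPrinted D.C ∧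
        DagBinding.EndpointExistence D.C.toB12 ∧ T4ApexHybrid.HybridNE7Under D (DagBinding.EndpointExistence D.C.toB12)) :
    YMDAG.UVSplit.UVD59 N :=
  fun F => hS F (hE F (hB F))

end Stage0

/-- **At `N = 2` the Stage-0 chain concludes the spine's leaf `Theses.BalabanLadder.UV` BY NAME** (`YMDAG.UVSplit.uvD59_two_iff`); the three
hypotheses are verbatim the bodies of Track A's rev-11 cruxes. -/
theorem uv_of_stage0Chain_two
    (hB : ∀ F : T4Family, ∃ D : FiniteEpsData F (Matrix.specialUnitaryGroup (Fin 2) ℂ), Node00.IsDatumOfRecord₀ F 2 D ∧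
      B16.EndStatementBPrinted D.C ∧ ∃ γ₁ : ℝ, 0 < γ₁ ∧ ∀ γ : ℝ, 0 < γ → γ ≤ γ₁ → ∃ P : B12.RunParams, (D.C P).flow.InInterval γ P.K)
    (hE : ∀ F : T4Family, (∃ D : FiniteEpsData F (Matrix.specialUnitaryGroup (Fin 2) ℂ), Node00.IsDatumOfRecord₀ F 2 D ∧
        B16.EndStatementBPrinted D.C ∧ ∃ γ₁ : ℝ, 0 < γ₁ ∧ ∀ γ : ℝ, 0 < γ → γ ≤ γ₁ → ∃ P : B12.RunParams, (D.C P).flow.InInterval γ P.K) →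
      ∃ D : FiniteEpsData F (Matrix.specialUnitaryGroup (Fin 2) ℂ), Node00.IsDatumOfRecord₀ F 2 D ∧ B16.EndStatementBPrinted D.C ∧
        DagBinding.EndpointExistence D.C.toB12)
    (hS : ∀ F : T4Family, (∃ D : FiniteEpsData F (Matrix.specialUnitaryGroup (Fin 2) ℂ), Node00.IsDatumOfRecord₀ F 2 D ∧
        B16.EndStatementBPrinted D.C ∧ DagBinding.EndpointExistence D.C.toB12) →
      ∃ D : FiniteEpsData F (Matrix.specialUnitaryGroup (Fin 2) ℂ), Node00.IsDatumOfRecord₀ F 2 D ∧ B16.EndStatementBPrinted D.C ∧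
        DagBinding.EndpointExistence D.C.toB12 ∧ T4ApexHybrid.HybridNE7Under D (DagBinding.EndpointExistence D.C.toB12)) :
    Summit.QuantumFields.YangMills.Theses.BalabanLadder.UV :=
  YMDAG.UVSplit.uvD59_two_iff.1 (uvD59_of_stage0Chain hB hE hS)

/-- **The R85 piece `UVApexSUN` from the Stage-0 chain for every `N ≥ 3`** (`∀ N ≥ 3, YMDAG.UVSplit.UVD59 N`). -/
theorem uvApexSUN_of_stage0Chain
    (hB : ∀ (N : ℕ) [NeZero N], 3 ≤ N → ∀ F : T4Family, ∃ D : FiniteEpsData F (Matrix.specialUnitaryGroup (Fin N) ℂ),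
      Node00.IsDatumOfRecord₀ F N D ∧ B16.EndStatementBPrinted D.C ∧
      ∃ γ₁ : ℝ, 0 < γ₁ ∧ ∀ γ : ℝ, 0 < γ → γ ≤ γ₁ → ∃ P : B12.RunParams, (D.C P).flow.InInterval γ P.K)
    (hE : ∀ (N : ℕ) [NeZero N], 3 ≤ N → ∀ F : T4Family, (∃ D : FiniteEpsData F (Matrix.specialUnitaryGroup (Fin N) ℂ),
        Node00.IsDatumOfRecord₀ F N D ∧ B16.EndStatementBPrinted D.C ∧
        ∃ γ₁ : ℝ, 0 < γ₁ ∧ ∀ γ : ℝ, 0 < γ → γ ≤ γ₁ → ∃ P : B12.RunParams, (D.C P).flow.InInterval γ P.K) →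
      ∃ D : FiniteEpsData F (Matrix.specialUnitaryGroup (Fin N) ℂ), Node00.IsDatumOfRecord₀ F N D ∧ B16.EndStatementBPrinted D.C ∧
        DagBinding.EndpointExistence D.C.toB12)
    (hS : ∀ (N : ℕ) [NeZero N], 3 ≤ N → ∀ F : T4Family, (∃ D : FiniteEpsData F (Matrix.specialUnitaryGroup (Fin N) ℂ),
        Node00.IsDatumOfRecord₀ F N D ∧ B16.EndStatementBPrinted D.C ∧ DagBinding.EndpointExistence D.C.toB12) →
      ∃ D : FiniteEpsData F (Matrix.specialUnitaryGroup (Fin N) ℂ), Node00.IsDatumOfRecord₀ F N D ∧ B16.EndStatementBPrinted D.C ∧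
        DagBinding.EndpointExistence D.C.toB12 ∧ T4ApexHybrid.HybridNE7Under D (DagBinding.EndpointExistence D.C.toB12)) :
    ∀ (N : ℕ) [NeZero N], 3 ≤ N → YMDAG.UVSplit.UVD59 N :=
  fun N _ hN => uvD59_of_stage0Chain (hB N hN) (hE N hN) (hS N hN)

/-- **`UVSUN` from the Stage-0 chain for every `N ≥ 2`** (its `N = 2` instance is the spine's `UV`, `uv_of_uvSUN`). -/
theorem uvSUN_of_stage0Chain
    (hB : ∀ (N : ℕ) [NeZero N], 2 ≤ N → ∀ F : T4Family, ∃ D : FiniteEpsData F (Matrix.specialUnitaryGroup (Fin N) ℂ),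
      Node00.IsDatumOfRecord₀ F N D ∧ B16.EndStatementBPrinted D.C ∧
      ∃ γ₁ : ℝ, 0 < γ₁ ∧ ∀ γ : ℝ, 0 < γ → γ ≤ γ₁ → ∃ P : B12.RunParams, (D.C P).flow.InInterval γ P.K)
    (hE : ∀ (N : ℕ) [NeZero N], 2 ≤ N → ∀ F : T4Family, (∃ D : FiniteEpsData F (Matrix.specialUnitaryGroup (Fin N) ℂ),
        Node00.IsDatumOfRecord₀ F N D ∧ B16.EndStatementBPrinted D.C ∧
        ∃ γ₁ : ℝ, 0 < γ₁ ∧ ∀ γ : ℝ, 0 < γ → γ ≤ γ₁ → ∃ P : B12.RunParams, (D.C P).flow.InInterval γ P.K) →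
      ∃ D : FiniteEpsData F (Matrix.specialUnitaryGroup (Fin N) ℂ), Node00.IsDatumOfRecord₀ F N D ∧ B16.EndStatementBPrinted D.C ∧
        DagBinding.EndpointExistence D.C.toB12)
    (hS : ∀ (N : ℕ) [NeZero N], 2 ≤ N → ∀ F : T4Family, (∃ D : FiniteEpsData F (Matrix.specialUnitaryGroup (Fin N) ℂ),
        Node00.IsDatumOfRecord₀ F N D ∧ B16.EndStatementBPrinted D.C ∧ DagBinding.EndpointExistence D.C.toB12) →
      ∃ D : FiniteEpsData F (Matrix.specialUnitaryGroup (Fin N) ℂ), Node00.IsDatumOfRecord₀ F N D ∧ B16.EndStatementBPrinted D.C ∧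
        DagBinding.EndpointExistence D.C.toB12 ∧ T4ApexHybrid.HybridNE7Under D (DagBinding.EndpointExistence D.C.toB12)) :
    UVSUN :=
  fun N _ hN => uvD59_of_stage0Chain (hB N hN) (hE N hN) (hS N hN)

end Summit.QuantumFields.YangMills.Theorems.UVOtherGroups

end
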